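import Summits.Ventures.DiscreteObjects.Hadamard.Order167CirculantArray668
import Summits.Ventures.DiscreteObjects.Hadamard.Order167InvertingNormalizer668
import Summits.Ventures.DiscreteObjects.Hadamard.Order167InvertingFreeArray668
import Summits.Ventures.DiscreteObjects.Hadamard.Order167WilliamsonIff668
import Summits.Ventures.DiscreteObjects.Hadamard.WilliamsonSequences167Iff668
import Summits.Ventures.DiscreteObjects.Hadamard.Order334InvertingFixedWilliamson668
import Summits.Ventures.DiscreteObjects.Hadamard.Order334ItoTfae668

/-!
# Hadamard 668 census — the 167-local dictionary of a hypothetical H(668), ONE citation point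

Framing: lottery ticket; floor = certified bounds/negative ranges.

Cell pub-namedobj (venture DiscreteObjects), target (H).  Gens 19–23 proved, leaf by leaf, that the presence of an
automorphism `σ` of pair order `167` in the signed automorphism group of a putative Hadamard matrix of order `668`, with
each possible shape of its centraliser `C̄ = C(σ)/±⟨σ⟩ ≤ V₄` and normaliser `N̄ = N(⟨σ⟩)/±⟨σ⟩` (elementary abelian of
order `≤ 8`), is EQUIVALENT to the existence of a Hadamard matrix of order `668` in a classical structured family
(HANDOFF-H-g23 table).  This file restates the seven established equivalences as a single conjunction — no new
mathematics, each conjunct is `exact` an accepted theorem: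
1. `167 ∣` order of an automorphism ⇔ a `4 × 4` array of circulant `±1` blocks of order `167` (gen 19,
   `hadamard668_aut167_iff_circulantArray`);
2. `σ₁₆₇` + a block-preserving inverting automorphism (`τστ⁻¹ = σ⁻¹`, stated with `μ = 166`) ⇔ sixteen SYMMETRIC
   circulants (gen 20, `hadamard668_aut167_inverting_iff_symmetricCirculantArray`);
3. `σ₁₆₇` + a fixed-point-free inverting automorphism ⇔ a paired-transpose circulant array (gen 23,
   `hadamard668_aut167_inverting_fpf_iff_pairedCirculantArray`);
4. `σ₁₆₇` with two distinct commuting centralising involutions (index 4) ⇔ a Williamson-TYPE array on circulant blocks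
   (gen 21, `hadamard668_index_four_iff_williamsonType`);
5. index 4 + an inverting automorphism (`|N̄| = 8`) ⇔ WILLIAMSON SEQUENCES of length `167` (gen 22,
   `hadamard668_normalizer_index_eight_iff_williamsonSequences`);
6. an element of pair order `334` inverted by a row-fixing automorphism ⇔ Williamson sequences of length `167`
   (gen 23, `hadamard668_order334_inverting_fixed_iff_williamsonSequences`);
7. the seven-form TFAE of the order-334 line = Ito's conjecture at `t = 167`: pair order `334` ⇔ `σ₁₆₇` + a
   centralising involution ⇔ negaperiodic Golay pair of length `334` ⇔ quasi-Williamson quadruple of order `167` ⇔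
   Ito-type H(668) ⇔ Hadamard `2 × 2` negacyclic array ⇔ the regular `⟨σ⟩ ⋊ V₄` configuration (gen 23,
   `hadamard668_order334_tfae`).
Every right-hand side is OPEN (Williamson sequences are classified only for odd `n ≤ 59`/`≤ 70`; Ito-type / NGP(334) /
QW(167) unknown; no `4 × 4` circulant array of order `167` blocks is known); no order is excluded; H(668) untouched.
Dictionary only; HITS 0.  No `sorry`.
-/

namespace Summit.Ventures.DiscreteObjects.Hadamard

open Finset BigOperators Matrix

open Literature.Combinatorics.Designs.GoethalsSeidel (IsHadamardMatrix circT)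
open Literature.Combinatorics.Designs.LegendrePairs (PAF IsPM)
open Literature.Combinatorics.Designs.ItoArray (itoMatrix)

/-- **The 167-local dictionary of a hypothetical H(668)** (gens 19–23, one conjunction; see the module docstring for
the seven conjuncts).  Inverting automorphisms are stated with the exponent `166` (`τστ⁻¹ = σ¹⁶⁶ = σ⁻¹`). -/
theorem hadamard668_order167_dictionary :
    -- 1 (gen 19): 167 ∣ |automorphism| ⇔ sixteen circulant blocks
    ((∃ (ι : Type) (_ : Fintype ι) (_ : DecidableEq ι) (H : Matrix ι ι ℤ) (π κ : Equiv.Perm ι) (d e : ι → ℤ),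
        Fintype.card ι = 668 ∧ IsHadamardMatrix H ∧ IsSignedAut H π κ d e ∧
        167 ∣ orderOf ((π, κ) : Equiv.Perm ι × Equiv.Perm ι)) ↔
      ∃ x : Fin 4 → Fin 4 → ZMod 167 → ℤ,
        IsHadamardMatrix (Matrix.of fun (a b : Fin 4 × ZMod 167) => x a.1 b.1 (b.2 - a.2))) ∧
    -- 2 (gen 20): σ₁₆₇ + block-preserving inverting automorphism ⇔ sixteen symmetric circulant blocks
    ((∃ (ι : Type) (_ : Fintype ι) (_ : DecidableEq ι) (H : Matrix ι ι ℤ) (π κ π' κ' : Equiv.Perm ι)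
        (d e d' e' : ι → ℤ),
        Fintype.card ι = 668 ∧ IsHadamardMatrix H ∧ IsSignedAut H π κ d e ∧ π ^ 167 = 1 ∧ κ ^ 167 = 1 ∧
        (π ≠ 1 ∨ κ ≠ 1) ∧ IsSignedAut H π' κ' d' e' ∧ π' * π = π ^ 166 * π' ∧ κ' * κ = κ ^ 166 * κ' ∧
        (∀ x, π' x ∈ orbFin π 167 x) ∧ (∀ y, κ' y ∈ orbFin κ 167 y)) ↔
      ∃ x : Fin 4 → Fin 4 → ZMod 167 → ℤ,
        IsHadamardMatrix (Matrix.of fun (a b : Fin 4 × ZMod 167) => x a.1 b.1 (b.2 - a.2)) ∧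
          ∀ p q r, x p q (-r) = x p q r) ∧
    -- 3 (gen 23): σ₁₆₇ + fixed-point-free inverting automorphism ⇔ paired-transpose circulant array
    ((∃ (ι : Type) (_ : Fintype ι) (_ : DecidableEq ι) (H : Matrix ι ι ℤ) (π κ π' κ' : Equiv.Perm ι)
        (d e d' e' : ι → ℤ),
        Fintype.card ι = 668 ∧ IsHadamardMatrix H ∧ IsSignedAut H π κ d e ∧ π ^ 167 = 1 ∧ κ ^ 167 = 1 ∧
        (π ≠ 1 ∨ κ ≠ 1) ∧ IsSignedAut H π' κ' d' e' ∧ π' * π = π ^ 166 * π' ∧ κ' * κ = κ ^ 166 * κ' ∧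
        ∀ x, π' x ≠ x) ↔
      ∃ (τ τ' : Equiv.Perm (Fin 4)) (ε ε' : Fin 4 → ℤ) (x : Fin 4 → Fin 4 → ZMod 167 → ℤ),
        (∀ p, τ p ≠ p) ∧ (∀ p, τ (τ p) = p) ∧ (∀ q, τ' q ≠ q) ∧ (∀ q, τ' (τ' q) = q) ∧
        (∀ p, ε p = 1 ∨ ε p = -1) ∧ (∀ q, ε' q = 1 ∨ ε' q = -1) ∧ (∀ p, ε (τ p) = -ε p) ∧ (∀ q, ε' (τ' q) = -ε' q) ∧
        (∀ p q r, x (τ p) (τ' q) (-r) = ε p * ε' q * x p q r) ∧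
        IsHadamardMatrix (Matrix.of fun (a b : Fin 4 × ZMod 167) => x a.1 b.1 (b.2 - a.2))) ∧
    -- 4 (gen 21): index-4 centraliser ⇔ Williamson-type array on circulant blocks
    ((∃ (ι : Type) (_ : Fintype ι) (_ : DecidableEq ι) (H : Matrix ι ι ℤ) (π κ π₁ κ₁ π₂ κ₂ : Equiv.Perm ι)
        (d e d₁ e₁ d₂ e₂ : ι → ℤ), Fintype.card ι = 668 ∧ IsHadamardMatrix H ∧ IsSignedAut H π κ d e ∧ π ^ 167 = 1 ∧
        κ ^ 167 = 1 ∧ (π ≠ 1 ∨ κ ≠ 1) ∧ IsSignedAut H π₁ κ₁ d₁ e₁ ∧ IsSignedAut H π₂ κ₂ d₂ e₂ ∧ Commute π₁ π ∧ Commute κ₁ κ ∧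
        Commute π₂ π ∧ Commute κ₂ κ ∧ π₁ ^ 2 = 1 ∧ κ₁ ^ 2 = 1 ∧ π₂ ^ 2 = 1 ∧ κ₂ ^ 2 = 1 ∧ (π₁ ≠ 1 ∨ κ₁ ≠ 1) ∧
        (π₂ ≠ 1 ∨ κ₂ ≠ 1) ∧ (π₁ ≠ π₂ ∨ κ₁ ≠ κ₂)) ↔
      ∃ A : ZMod 2 × ZMod 2 → ZMod 167 → ℤ,
        IsHadamardMatrix (Matrix.of fun (a b : (ZMod 2 × ZMod 2) × ZMod 167) =>
          (if a.1 = 0 then (1 : ℤ) else if a.1 = (1, 0) then (if b.1.1 = 1 then 1 else -1)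
            else if a.1 = (0, 1) then (if b.1.1 = b.1.2 then -1 else 1) else (if b.1.2 = 1 then 1 else -1)) *
          A (a.1 + b.1) (b.2 - a.2))) ∧
    -- 5 (gen 22): index 4 + inverting automorphism (|N̄| = 8) ⇔ Williamson sequences of length 167
    ((∃ (ι : Type) (_ : Fintype ι) (_ : DecidableEq ι) (H : Matrix ι ι ℤ) (π κ π₁ κ₁ π₂ κ₂ π' κ' : Equiv.Perm ι)
        (d e d₁ e₁ d₂ e₂ d' e' : ι → ℤ) (μ : ℕ), Fintype.card ι = 668 ∧ IsHadamardMatrix H ∧ IsSignedAut H π κ d e ∧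
        π ^ 167 = 1 ∧ κ ^ 167 = 1 ∧ (π ≠ 1 ∨ κ ≠ 1) ∧ IsSignedAut H π₁ κ₁ d₁ e₁ ∧ IsSignedAut H π₂ κ₂ d₂ e₂ ∧
        Commute π₁ π ∧ Commute κ₁ κ ∧ Commute π₂ π ∧ Commute κ₂ κ ∧ π₁ ^ 2 = 1 ∧ κ₁ ^ 2 = 1 ∧ π₂ ^ 2 = 1 ∧ κ₂ ^ 2 = 1 ∧
        (π₁ ≠ 1 ∨ κ₁ ≠ 1) ∧ (π₂ ≠ 1 ∨ κ₂ ≠ 1) ∧ (π₁ ≠ π₂ ∨ κ₁ ≠ κ₂) ∧ IsSignedAut H π' κ' d' e' ∧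
        π' * π = π ^ μ * π' ∧ κ' * κ = κ ^ μ * κ' ∧ μ % 167 = 166) ↔
      ∃ a b c d : ZMod 167 → ℤ, IsPM a ∧ IsPM b ∧ IsPM c ∧ IsPM d ∧ (∀ i, a (-i) = a i) ∧ (∀ i, b (-i) = b i) ∧
        (∀ i, c (-i) = c i) ∧ (∀ i, d (-i) = d i) ∧
        ∀ s : ZMod 167, s ≠ 0 → PAF a s + PAF b s + PAF c s + PAF d s = 0) ∧
    -- 6 (gen 23): pair order 334 + row-fixing inverting automorphism ⇔ Williamson sequences of length 167
    ((∃ (ι : Type) (_ : Fintype ι) (_ : DecidableEq ι) (H : Matrix ι ι ℤ) (π κ π' κ' : Equiv.Perm ι)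
        (d e d' e' : ι → ℤ) (ν : ℕ) (x₀ : ι), Fintype.card ι = 668 ∧ IsHadamardMatrix H ∧ IsSignedAut H π κ d e ∧
        orderOf ((π, κ) : Equiv.Perm ι × Equiv.Perm ι) = 334 ∧ IsSignedAut H π' κ' d' e' ∧
        π' * π = π ^ ν * π' ∧ κ' * κ = κ ^ ν * κ' ∧ ν % 334 = 333 ∧ π' x₀ = x₀) ↔
      ∃ a b c d : ZMod 167 → ℤ, IsPM a ∧ IsPM b ∧ IsPM c ∧ IsPM d ∧ (∀ i, a (-i) = a i) ∧ (∀ i, b (-i) = b i) ∧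
        (∀ i, c (-i) = c i) ∧ (∀ i, d (-i) = d i) ∧
        ∀ s : ZMod 167, s ≠ 0 → PAF a s + PAF b s + PAF c s + PAF d s = 0) ∧
    -- 7 (gen 23): the order-334 line, seven equivalent forms (Ito's conjecture at t = 167)
    List.TFAE [
      ∃ (ι : Type) (_ : Fintype ι) (_ : DecidableEq ι) (H : Matrix ι ι ℤ) (π κ : Equiv.Perm ι) (d e : ι → ℤ),
        Fintype.card ι = 668 ∧ IsHadamardMatrix H ∧ IsSignedAut H π κ d e ∧
        orderOf ((π, κ) : Equiv.Perm ι × Equiv.Perm ι) = 334,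
      ∃ (ι : Type) (_ : Fintype ι) (_ : DecidableEq ι) (H : Matrix ι ι ℤ) (π κ π₁ κ₁ : Equiv.Perm ι) (d e d₁ e₁ : ι → ℤ),
        Fintype.card ι = 668 ∧ IsHadamardMatrix H ∧ IsSignedAut H π κ d e ∧ π ^ 167 = 1 ∧ κ ^ 167 = 1 ∧ (π ≠ 1 ∨ κ ≠ 1) ∧
        IsSignedAut H π₁ κ₁ d₁ e₁ ∧ Commute π₁ π ∧ Commute κ₁ κ ∧ π₁ ^ 2 = 1 ∧ κ₁ ^ 2 = 1 ∧ (π₁ ≠ 1 ∨ κ₁ ≠ 1),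
      ∃ u v : ZMod 668 → ℤ, IsPM u ∧ IsPM v ∧ (∀ x, u (x + 334) = -u x) ∧ (∀ x, v (x + 334) = -v x) ∧
        ∀ s : ZMod 668, s ≠ 0 → s ≠ 334 → PAF u s + PAF v s = 0,
      ∃ a b c d : ZMod 167 → ℤ, IsPM a ∧ IsPM b ∧ IsPM c ∧ IsPM d ∧
        (∀ r : ZMod 167, r ≠ 0 → PAF a r + PAF b r + PAF c r + PAF d r = 0) ∧
        circulant a * circT b + circulant c * circT d = circulant b * circT a + circulant d * circT c,
      ∃ a b c d : ZMod 167 → ℤ, IsHadamardMatrix (itoMatrix a b c d),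
      ∃ x : Fin 2 → Fin 2 → ZMod 668 → ℤ, (∀ p q r, x p q (r + 334) = -x p q r) ∧
        IsHadamardMatrix (Matrix.of fun (a b : Fin 2 × ZMod 334) =>
          x a.1 b.1 ((b.2.val : ZMod 668) - (a.2.val : ZMod 668))),
      ∃ (ι : Type) (_ : Fintype ι) (_ : DecidableEq ι) (H : Matrix ι ι ℤ) (π κ π₁ κ₁ π₂ κ₂ : Equiv.Perm ι)
          (d e d₁ e₁ d₂ e₂ : ι → ℤ) (μ : ℕ), Fintype.card ι = 668 ∧ IsHadamardMatrix H ∧ IsSignedAut H π κ d e ∧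
          π ^ 167 = 1 ∧ κ ^ 167 = 1 ∧ (π ≠ 1 ∨ κ ≠ 1) ∧ IsSignedAut H π₁ κ₁ d₁ e₁ ∧ Commute π₁ π ∧ Commute κ₁ κ ∧
          π₁ ^ 2 = 1 ∧ κ₁ ^ 2 = 1 ∧ (π₁ ≠ 1 ∨ κ₁ ≠ 1) ∧ IsSignedAut H π₂ κ₂ d₂ e₂ ∧ π₂ * π = π ^ μ * π₂ ∧
          κ₂ * κ = κ ^ μ * κ₂ ∧ μ % 167 = 166 ∧ (∀ x, π₂ x ≠ x) ∧ (∀ x, (π₂ * π₁) x ≠ x)] :=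
  ⟨hadamard668_aut167_iff_circulantArray,
    hadamard668_aut167_inverting_iff_symmetricCirculantArray 166 (by norm_num),
    hadamard668_aut167_inverting_fpf_iff_pairedCirculantArray 166 (by norm_num),
    hadamard668_index_four_iff_williamsonType,
    hadamard668_normalizer_index_eight_iff_williamsonSequences,
    hadamard668_order334_inverting_fixed_iff_williamsonSequences,
    hadamard668_order334_tfae⟩

end Summit.Ventures.DiscreteObjects.Hadamard
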